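import Summits.ValiantsHypothesis.ValiantsHypothesis.Theorems.LacunarySymmetroidMatrixDescartesDoorA26WallBubblingSecondOrderOpening

/-!
# `DoorA26` / line `wall_bubbling` — WITNESSES for the second-order openings: quadratics with positive discriminant, cubics with `B² > 3Ae₁`

HONEST FRAMING.  Object-search cell `pub-symmetroid`, crux `Theses.LacunarySymmetroid.DoorA26` (stmt-ValiantsHypothesis-19979; OPEN, typed,
never asserted).  W2 seat val-sym-door-p1 g20, file #86; def-free helper for obligation (R) of `Cruxes/DoorA26/Lines/wall_bubbling.lean`.
Imports #82 `…SecondOrderOpening`.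

WHY.  #82 `mem_twentyLocus_of_secondOrder_openings` wants, at each touch, three NON-ZERO abscissae at which the quadratic `Aσ² + Bσ + C` alternates in
sign and, at each triple zero, four at which the cubic `Aσ³ + Bσ² + e₁σ + e₃` alternates; the level-2 dichotomy #87 delivers instead the discriminant
`B² − 4AC > 0` and the condition `B² > 3Ae₁` (memo `DOOR-A26-P1G20-NEWTON-LIFT.md` §3.3 (i), (iii)).  This file closes the gap with EXPLICIT witnesses
(no root isolation): for the quadratic, points at distance `Δ = r₂ − r₁` outside the roots and near the midpoint, moved by a fixed fraction of `Δ` when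
they would hit `0`; for the cubic, parametrised by its critical points `x < y` (`g′ = 3A(σ−x)(σ−y)`), the free constant `e₃` is chosen so that
`g(x) = −g(y) = AΔ³/4` (`Δ = y − x`), and the four witnesses are `x − Δ` (or `x − 2Δ`), `x` (or `x + Δ/4`), `y` (or `y − Δ/4`), `y + Δ` (or `y + 2Δ`), with
the values `−9H, H, −H, 9H` (`H = AΔ³/4`) and their substitutes computed by `ring` from the Taylor form at a critical point.

WHAT IS HERE.  `quadratic_witnesses` (∃ three increasing non-zero abscissae with signs `A, −A, A`), `cubic_taylor_at_critical`, `cubic_witnesses`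
(∃ `e₃` and four increasing non-zero abscissae with signs `−A, A, −A, A`).  Nothing here bears on `DoorA26`, `DoorA34`, (W)/(M)/(R), `MatrixDescartes`
(18050) or `VP ≠ VNP`; registers unchanged.

[folklore] quadratic and cubic sign patterns.  [this work] the explicit witnesses.
-/

set_option linter.dupNamespace false

namespace Summit.ValiantsHypothesis.ValiantsHypothesis.Theorems.LacunarySymmetroidMatrixDescartes.WallBubbling

open Finset Filter Topology

/-! ## §1 Quadratics with positive discriminant -/

/-- **Quadratic witnesses.**  `A ≠ 0`, `B² − 4AC > 0` ⇒ three increasing NON-ZERO abscissae `σ₀ < σ₁ < σ₂` with `A·q(σ₀) > 0`, `A·q(σ₁) < 0`,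
`A·q(σ₂) > 0` for `q(σ) = Aσ² + Bσ + C`. [folklore] -/
theorem quadratic_witnesses {A B C : ℝ} (hA : A ≠ 0) (hD : 0 < B ^ 2 - 4 * A * C) :
    ∃ σ₀ σ₁ σ₂ : ℝ, σ₀ < σ₁ ∧ σ₁ < σ₂ ∧ σ₀ ≠ 0 ∧ σ₁ ≠ 0 ∧ σ₂ ≠ 0 ∧
      0 < A * (A * σ₀ ^ 2 + B * σ₀ + C) ∧ A * (A * σ₁ ^ 2 + B * σ₁ + C) < 0 ∧ 0 < A * (A * σ₂ ^ 2 + B * σ₂ + C) := by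
  -- ordered roots `r₁ < r₂` with `q = A(σ − r₁)(σ − r₂)`
  obtain ⟨r₁, r₂, hlt, hq⟩ : ∃ r₁ r₂ : ℝ, r₁ < r₂ ∧ ∀ σ, A * σ ^ 2 + B * σ + C = A * ((σ - r₁) * (σ - r₂)) := by
    set R := Real.sqrt (B ^ 2 - 4 * A * C) with hR
    have hRpos : 0 < R := Real.sqrt_pos.2 hD
    have hR2 : R ^ 2 = B ^ 2 - 4 * A * C := Real.sq_sqrt hD.le
    have hfac : ∀ σ, A * σ ^ 2 + B * σ + C = A * ((σ - (-B - R) / (2 * A)) * (σ - (-B + R) / (2 * A))) := by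
      intro σ; field_simp; linear_combination hR2
    rcases lt_or_gt_of_ne hA with hneg | hpos
    · refine ⟨(-B + R) / (2 * A), (-B - R) / (2 * A), ?_, fun σ => by rw [hfac σ]; ring⟩
      rw [div_lt_div_right_of_neg (by linarith)]
      linarith
    · refine ⟨(-B - R) / (2 * A), (-B + R) / (2 * A), ?_, hfac⟩
      rw [div_lt_div_iff_of_pos_right (by linarith)]
      linarith
  set Δ := r₂ - r₁ with hΔ
  have hΔpos : 0 < Δ := by rw [hΔ]; linarith
  have hA2 : 0 < A * A := mul_self_pos.2 hA
  -- the three witnesses, nudged off `0`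
  let σ₀ : ℝ := if r₁ - Δ ≠ 0 then r₁ - Δ else r₁ - 2 * Δ
  let σ₁ : ℝ := if r₁ + Δ / 2 ≠ 0 then r₁ + Δ / 2 else r₁ + Δ / 4
  let σ₂ : ℝ := if r₂ + Δ ≠ 0 then r₂ + Δ else r₂ + 2 * Δ
  have h0 : σ₀ = r₁ - Δ ∨ σ₀ = r₁ - 2 * Δ := by
    by_cases h : r₁ - Δ ≠ 0
    · exact Or.inl (if_pos h)
    · exact Or.inr (if_neg h)
  have h1 : σ₁ = r₁ + Δ / 2 ∨ σ₁ = r₁ + Δ / 4 := by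
    by_cases h : r₁ + Δ / 2 ≠ 0
    · exact Or.inl (if_pos h)
    · exact Or.inr (if_neg h)
  have h2 : σ₂ = r₂ + Δ ∨ σ₂ = r₂ + 2 * Δ := by
    by_cases h : r₂ + Δ ≠ 0
    · exact Or.inl (if_pos h)
    · exact Or.inr (if_neg h)
  refine ⟨σ₀, σ₁, σ₂, ?_, ?_, ?_, ?_, ?_, ?_, ?_, ?_⟩
  · rcases h0 with h | h <;> rcases h1 with h' | h' <;> rw [h, h'] <;> linarith
  · rcases h1 with h | h <;> rcases h2 with h' | h' <;> rw [h, h', hΔ] <;> linarith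
  · by_cases h : r₁ - Δ ≠ 0
    · show (if r₁ - Δ ≠ 0 then r₁ - Δ else r₁ - 2 * Δ) ≠ 0
      rw [if_pos h]; exact h
    · show (if r₁ - Δ ≠ 0 then r₁ - Δ else r₁ - 2 * Δ) ≠ 0
      rw [if_neg h]; push Not at h; intro h'; linarith
  · by_cases h : r₁ + Δ / 2 ≠ 0
    · show (if r₁ + Δ / 2 ≠ 0 then r₁ + Δ / 2 else r₁ + Δ / 4) ≠ 0
      rw [if_pos h]; exact h
    · show (if r₁ + Δ / 2 ≠ 0 then r₁ + Δ / 2 else r₁ + Δ / 4) ≠ 0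
      rw [if_neg h]; push Not at h; intro h'; linarith
  · by_cases h : r₂ + Δ ≠ 0
    · show (if r₂ + Δ ≠ 0 then r₂ + Δ else r₂ + 2 * Δ) ≠ 0
      rw [if_pos h]; exact h
    · show (if r₂ + Δ ≠ 0 then r₂ + Δ else r₂ + 2 * Δ) ≠ 0
      rw [if_neg h]; push Not at h; intro h'; linarith
  · rw [hq]
    rcases h0 with h | h <;> rw [h]
    · have e : A * (A * ((r₁ - Δ - r₁) * (r₁ - Δ - r₂))) = 2 * (A * A) * Δ ^ 2 := by rw [hΔ]; ring
      rw [e]; exact mul_pos (mul_pos two_pos hA2) (pow_pos hΔpos 2)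
    · have e : A * (A * ((r₁ - 2 * Δ - r₁) * (r₁ - 2 * Δ - r₂))) = 6 * (A * A) * Δ ^ 2 := by rw [hΔ]; ring
      rw [e]; exact mul_pos (mul_pos (by norm_num) hA2) (pow_pos hΔpos 2)
  · rw [hq]
    rcases h1 with h | h <;> rw [h]
    · have e : A * (A * ((r₁ + Δ / 2 - r₁) * (r₁ + Δ / 2 - r₂))) = -((A * A) * Δ ^ 2 / 4) := by rw [hΔ]; ring
      rw [e]; exact neg_neg_of_pos (div_pos (mul_pos hA2 (pow_pos hΔpos 2)) four_pos)
    · have e : A * (A * ((r₁ + Δ / 4 - r₁) * (r₁ + Δ / 4 - r₂))) = -(3 * ((A * A) * Δ ^ 2) / 16) := by rw [hΔ]; ring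
      rw [e]; exact neg_neg_of_pos (div_pos (mul_pos three_pos (mul_pos hA2 (pow_pos hΔpos 2))) (by norm_num))
  · rw [hq]
    rcases h2 with h | h <;> rw [h]
    · have e : A * (A * ((r₂ + Δ - r₁) * (r₂ + Δ - r₂))) = 2 * (A * A) * Δ ^ 2 := by rw [hΔ]; ring
      rw [e]; exact mul_pos (mul_pos two_pos hA2) (pow_pos hΔpos 2)
    · have e : A * (A * ((r₂ + 2 * Δ - r₁) * (r₂ + 2 * Δ - r₂))) = 6 * (A * A) * Δ ^ 2 := by rw [hΔ]; ring
      rw [e]; exact mul_pos (mul_pos (by norm_num) hA2) (pow_pos hΔpos 2)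

/-! ## §2 Cubics with two critical points -/

/-- Taylor form of a cubic at a critical point: if `g′ = 3A(σ−x)(σ−y)` and `g(σ) = A(σ³ − (3/2)(x+y)σ² + 3xyσ) + K` then
`g(σ) = g(x) + (3A(x−y)/2)(σ−x)² + A(σ−x)³`. [folklore] -/
theorem cubic_taylor_at_critical (A x y K σ : ℝ) :
    A * (σ ^ 3 - 3 / 2 * (x + y) * σ ^ 2 + 3 * x * y * σ) + K
      = (A * (x ^ 3 - 3 / 2 * (x + y) * x ^ 2 + 3 * x * y * x) + K) + 3 * A * (x - y) / 2 * (σ - x) ^ 2 + A * (σ - x) ^ 3 := by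
  ring

/-- **Cubic witnesses.**  `A ≠ 0` and `B² > 3Ae₁` ⇒ there are a constant `e₃` and four increasing NON-ZERO abscissae at which
`g(σ) = Aσ³ + Bσ² + e₁σ + e₃` has the signs `−A, A, −A, A` (so `g` has three simple real roots). [folklore] -/
theorem cubic_witnesses {A B e₁ : ℝ} (hA : A ≠ 0) (hD : 3 * A * e₁ < B ^ 2) :
    ∃ e₃ σ₀ σ₁ σ₂ σ₃ : ℝ, σ₀ < σ₁ ∧ σ₁ < σ₂ ∧ σ₂ < σ₃ ∧ σ₀ ≠ 0 ∧ σ₁ ≠ 0 ∧ σ₂ ≠ 0 ∧ σ₃ ≠ 0 ∧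
      A * (A * σ₀ ^ 3 + B * σ₀ ^ 2 + e₁ * σ₀ + e₃) < 0 ∧ 0 < A * (A * σ₁ ^ 3 + B * σ₁ ^ 2 + e₁ * σ₁ + e₃) ∧
      A * (A * σ₂ ^ 3 + B * σ₂ ^ 2 + e₁ * σ₂ + e₃) < 0 ∧ 0 < A * (A * σ₃ ^ 3 + B * σ₃ ^ 2 + e₁ * σ₃ + e₃) := by
  -- ordered critical points `x < y` with `B = −(3/2)A(x+y)`, `e₁ = 3Axy`
  obtain ⟨x, y, hlt, hB, he⟩ : ∃ x y : ℝ, x < y ∧ B = -(3 / 2) * A * (x + y) ∧ e₁ = 3 * A * (x * y) := by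
    have hD' : 0 < B ^ 2 - 3 * A * e₁ := by linarith
    set R := Real.sqrt (B ^ 2 - 3 * A * e₁) with hR
    have hRpos : 0 < R := Real.sqrt_pos.2 hD'
    have hR2 : R ^ 2 = B ^ 2 - 3 * A * e₁ := Real.sq_sqrt hD'.le
    have hsum : (-B - R) / (3 * A) + (-B + R) / (3 * A) = -(2 * B) / (3 * A) := by field_simp; ring
    have hprod : (-B - R) / (3 * A) * ((-B + R) / (3 * A)) = e₁ / (3 * A) := by
      field_simp; linear_combination (-1 : ℝ) * hR2
    rcases lt_or_gt_of_ne hA with hneg | hpos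
    · refine ⟨(-B + R) / (3 * A), (-B - R) / (3 * A), ?_, ?_, ?_⟩
      · rw [div_lt_div_right_of_neg (by linarith)]; linarith
      · have : (-B + R) / (3 * A) + (-B - R) / (3 * A) = -(2 * B) / (3 * A) := by rw [add_comm]; exact hsum
        rw [this]; field_simp
      · have : (-B + R) / (3 * A) * ((-B - R) / (3 * A)) = e₁ / (3 * A) := by rw [mul_comm]; exact hprod
        rw [this]; field_simp
    · refine ⟨(-B - R) / (3 * A), (-B + R) / (3 * A), ?_, ?_, ?_⟩
      · rw [div_lt_div_iff_of_pos_right (by linarith)]; linarith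
      · rw [hsum]; field_simp
      · rw [hprod]; field_simp
  set Δ := y - x with hΔ
  have hΔpos : 0 < Δ := by rw [hΔ]; linarith
  have hA2 : 0 < A * A := mul_self_pos.2 hA
  -- the cubic in critical-point form and the choice of the constant
  let g₀ : ℝ → ℝ := fun σ => A * (σ ^ 3 - 3 / 2 * (x + y) * σ ^ 2 + 3 * x * y * σ)
  let K : ℝ := -(g₀ x + g₀ y) / 2
  have hg : ∀ σ, A * σ ^ 3 + B * σ ^ 2 + e₁ * σ + K = A * (σ ^ 3 - 3 / 2 * (x + y) * σ ^ 2 + 3 * x * y * σ) + K := by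
    intro σ; rw [hB, he]; ring
  -- values: `H = AΔ³/4` at `x`, `−H` at `y`
  have hx : A * (x ^ 3 - 3 / 2 * (x + y) * x ^ 2 + 3 * x * y * x) + K = A * Δ ^ 3 / 4 := by
    show A * (x ^ 3 - 3 / 2 * (x + y) * x ^ 2 + 3 * x * y * x) + -(g₀ x + g₀ y) / 2 = A * Δ ^ 3 / 4
    simp only [g₀]; rw [hΔ]; ring
  have hval : ∀ σ, A * σ ^ 3 + B * σ ^ 2 + e₁ * σ + K = A * Δ ^ 3 / 4 + 3 * A * (x - y) / 2 * (σ - x) ^ 2 + A * (σ - x) ^ 3 := by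
    intro σ; rw [hg, cubic_taylor_at_critical, hx]
  -- the four witnesses, nudged off `0`
  let σ₀ : ℝ := if x - Δ ≠ 0 then x - Δ else x - 2 * Δ
  let σ₁ : ℝ := if x ≠ 0 then x else x + Δ / 4
  let σ₂ : ℝ := if y ≠ 0 then y else y - Δ / 4
  let σ₃ : ℝ := if y + Δ ≠ 0 then y + Δ else y + 2 * Δ
  have h0 : σ₀ = x - Δ ∨ σ₀ = x - 2 * Δ := by
    by_cases h : x - Δ ≠ 0
    · exact Or.inl (if_pos h)
    · exact Or.inr (if_neg h)
  have h1 : σ₁ = x ∨ σ₁ = x + Δ / 4 := by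
    by_cases h : x ≠ 0
    · exact Or.inl (if_pos h)
    · exact Or.inr (if_neg h)
  have h2 : σ₂ = y ∨ σ₂ = y - Δ / 4 := by
    by_cases h : y ≠ 0
    · exact Or.inl (if_pos h)
    · exact Or.inr (if_neg h)
  have h3 : σ₃ = y + Δ ∨ σ₃ = y + 2 * Δ := by
    by_cases h : y + Δ ≠ 0
    · exact Or.inl (if_pos h)
    · exact Or.inr (if_neg h)
  have hyx : y = x + Δ := by rw [hΔ]; ring
  refine ⟨K, σ₀, σ₁, σ₂, σ₃, ?_, ?_, ?_, ?_, ?_, ?_, ?_, ?_, ?_, ?_, ?_⟩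
  · rcases h0 with h | h <;> rcases h1 with h' | h' <;> rw [h, h'] <;> linarith
  · rcases h1 with h | h <;> rcases h2 with h' | h' <;> rw [h, h', hyx] <;> linarith
  · rcases h2 with h | h <;> rcases h3 with h' | h' <;> rw [h, h'] <;> linarith
  · by_cases h : x - Δ ≠ 0
    · show (if x - Δ ≠ 0 then x - Δ else x - 2 * Δ) ≠ 0
      rw [if_pos h]; exact h
    · show (if x - Δ ≠ 0 then x - Δ else x - 2 * Δ) ≠ 0
      rw [if_neg h]; push Not at h; intro h'; linarith
  · by_cases h : x ≠ 0
    · show (if x ≠ 0 then x else x + Δ / 4) ≠ 0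
      rw [if_pos h]; exact h
    · show (if x ≠ 0 then x else x + Δ / 4) ≠ 0
      rw [if_neg h]; push Not at h; intro h'; linarith
  · by_cases h : y ≠ 0
    · show (if y ≠ 0 then y else y - Δ / 4) ≠ 0
      rw [if_pos h]; exact h
    · show (if y ≠ 0 then y else y - Δ / 4) ≠ 0
      rw [if_neg h]; push Not at h; intro h'; linarith
  · by_cases h : y + Δ ≠ 0
    · show (if y + Δ ≠ 0 then y + Δ else y + 2 * Δ) ≠ 0
      rw [if_pos h]; exact h
    · show (if y + Δ ≠ 0 then y + Δ else y + 2 * Δ) ≠ 0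
      rw [if_neg h]; push Not at h; intro h'; linarith
  · rw [hval]
    rcases h0 with h | h <;> rw [h]
    · have e : A * (A * Δ ^ 3 / 4 + 3 * A * (x - y) / 2 * (x - Δ - x) ^ 2 + A * (x - Δ - x) ^ 3) = -(9 / 4) * (A * A) * Δ ^ 3 := by
        rw [hyx]; ring
      rw [e]; nlinarith [pow_pos hΔpos 3]
    · have e : A * (A * Δ ^ 3 / 4 + 3 * A * (x - y) / 2 * (x - 2 * Δ - x) ^ 2 + A * (x - 2 * Δ - x) ^ 3) = -(55 / 4) * (A * A) * Δ ^ 3 := by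
        rw [hyx]; ring
      rw [e]; nlinarith [pow_pos hΔpos 3]
  · rw [hval]
    rcases h1 with h | h <;> rw [h]
    · have e : A * (A * Δ ^ 3 / 4 + 3 * A * (x - y) / 2 * (x - x) ^ 2 + A * (x - x) ^ 3) = 1 / 4 * (A * A) * Δ ^ 3 := by ring
      rw [e]; nlinarith [pow_pos hΔpos 3]
    · have e : A * (A * Δ ^ 3 / 4 + 3 * A * (x - y) / 2 * (x + Δ / 4 - x) ^ 2 + A * (x + Δ / 4 - x) ^ 3) = 11 / 64 * (A * A) * Δ ^ 3 := by
        rw [hyx]; ring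
      rw [e]; nlinarith [pow_pos hΔpos 3]
  · rw [hval]
    rcases h2 with h | h <;> rw [h, hyx]
    · have e : A * (A * Δ ^ 3 / 4 + 3 * A * (x - (x + Δ)) / 2 * (x + Δ - x) ^ 2 + A * (x + Δ - x) ^ 3) = -(1 / 4) * (A * A) * Δ ^ 3 := by ring
      rw [e]; nlinarith [pow_pos hΔpos 3]
    · have e : A * (A * Δ ^ 3 / 4 + 3 * A * (x - (x + Δ)) / 2 * (x + Δ - Δ / 4 - x) ^ 2 + A * (x + Δ - Δ / 4 - x) ^ 3)
          = -(11 / 64) * (A * A) * Δ ^ 3 := by ring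
      rw [e]; nlinarith [pow_pos hΔpos 3]
  · rw [hval]
    rcases h3 with h | h <;> rw [h, hyx]
    · have e : A * (A * Δ ^ 3 / 4 + 3 * A * (x - (x + Δ)) / 2 * (x + Δ + Δ - x) ^ 2 + A * (x + Δ + Δ - x) ^ 3) = 9 / 4 * (A * A) * Δ ^ 3 := by ring
      rw [e]; nlinarith [pow_pos hΔpos 3]
    · have e : A * (A * Δ ^ 3 / 4 + 3 * A * (x - (x + Δ)) / 2 * (x + Δ + 2 * Δ - x) ^ 2 + A * (x + Δ + 2 * Δ - x) ^ 3)
          = 55 / 4 * (A * A) * Δ ^ 3 := by ring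
      rw [e]; nlinarith [pow_pos hΔpos 3]

end Summit.ValiantsHypothesis.ValiantsHypothesis.Theorems.LacunarySymmetroidMatrixDescartes.WallBubbling
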